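import Mathlib
import Summits.AtomisticToContinuum.Crystallization.Theorems.GappedShellCensusFiveFoldRationingRStubFfrSpread

/-!
# Crux `GappedShellCensus.FiveFoldRationingR` (stmt-AtomisticToContinuum-18071), line `Sketch` —
# stub `stub_ffrGreedy` (greedy routing)

In an all-gapped-twelve torn-free configuration `Y` at scale `a` whose shells have the
cuboctahedral, anticuboctahedral or prismatic bond graph, any two sites `u, v` are joined by a bond
path in `Y` of length `≤ 4 · dist u v / a + 3`.

## Proof

DIRECTIONAL SPREAD (`stub_ffrSpread`): for every site `u` and unit `d` some bond partner `w` of `u`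
has `⟪w − u, d⟫ ≥ (14/25) a`.  GREEDY STEP (`ffrG_step`): with `R = dist u v > 0` and
`d = (v − u)/R`, that partner satisfies `dist w v² = R² − 2 R ⟪w − u, d⟫ + |w − u|² ≤
R² − (28/25) a R + (51/50)² a²`.  ENDGAME: a distance `< (63/50) a` between sites is `0` or a
bond (the gap), so `R² ≤ 1.8084 a²` needs at most two bonds (`ffrG_two`: one step lands below
`1.4376 a² < (1.26 a)²`) and `R < (8/5) a` at most three.  ITERATION (`ffrG_iter`, induction on
`⌈4R/a⌉`): for `R ≥ (8/5) a` one step gains `≥ a/4` (`(R − a/4)² ≥ R² − 1.12 aR + 1.0404 a²` iff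
`0.62 R ≥ 0.9779 a`), and `1 + (4 (R − a/4)/a + 3) = 4R/a + 3`.
-/

noncomputable section

namespace Summit.AtomisticToContinuum.Crystallization.Theorems

open scoped RealInnerProductSpace

/-- Prepending a site to a bond path. [folklore] -/
theorem ffrG_prepend {Y : Set (EuclideanSpace ℝ (Fin 3))} {r : ℝ} {u v : EuclideanSpace ℝ (Fin 3)}
    (hu : u ∈ Y) {n : ℕ} {g : ℕ → EuclideanSpace ℝ (Fin 3)} (hg0 : dist u (g 0) ≤ r)
    (hgn : g n = v) (hgY : ∀ k, g k ∈ Y) (hgd : ∀ k, k < n → dist (g k) (g (k + 1)) ≤ r) :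
    ∃ g' : ℕ → EuclideanSpace ℝ (Fin 3), g' 0 = u ∧ g' (n + 1) = v ∧ (∀ k, g' k ∈ Y) ∧
      (∀ k, k < n + 1 → dist (g' k) (g' (k + 1)) ≤ r) := by
  refine ⟨fun k => Nat.casesOn k u g, rfl, hgn, fun k => ?_, fun k hk => ?_⟩
  · cases k with
    | zero => exact hu
    | succ j => exact hgY j
  · cases k with
    | zero => exact hg0
    | succ j => exact hgd j (by omega)

/-- **Endgame, one bond.**  Two sites at distance below the gap `(63/50) a` coincide or are bonded:
a bond path of length `≤ 1`. [folklore] -/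
theorem ffrG_close {Y : Set (EuclideanSpace ℝ (Fin 3))} {a : ℝ}
    (hwin : ∀ y ∈ Y, ∀ w ∈ Y, w ≠ y → a * (1 - 1 / 50) ≤ dist y w ∧
      (dist y w ≤ a * (1 + 1 / 50) ∨ a * (63 / 50) ≤ dist y w))
    {u v : EuclideanSpace ℝ (Fin 3)} (hu : u ∈ Y) (hv : v ∈ Y) (hlt : dist u v < a * (63 / 50)) :
    ∃ (n : ℕ) (g : ℕ → EuclideanSpace ℝ (Fin 3)), g 0 = u ∧ g n = v ∧ (∀ k, g k ∈ Y) ∧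
      (∀ k, k < n → dist (g k) (g (k + 1)) ≤ a * (1 + 1 / 50)) ∧ n ≤ 1 := by
  -- a distance below the gap is `0` or a bond
  by_cases huv : u = v
  · exact ⟨0, fun _ => u, rfl, huv, fun _ => hu, fun k hk => absurd hk (Nat.not_lt_zero k), zero_le_one⟩
  · have hb : dist u v ≤ a * (1 + 1 / 50) := by
      rcases (hwin u hu v hv (Ne.symm huv)).2 with h | h
      · exact h
      · linarith
    obtain ⟨g, hg0, hg1, hgY, hgd⟩ :=
      ffrG_prepend (r := a * (1 + 1 / 50)) hu (n := 0) (g := fun _ => v) hb rfl (fun _ => hv)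
        (fun k hk => absurd hk (Nat.not_lt_zero k))
    exact ⟨1, g, hg0, hg1, hgY, hgd, le_rfl⟩

/-- **One greedy step.**  For sites `u ≠ v` at distance `R`, the bond partner `w` of `u` best
aligned with `v − u` (directional spread `⟪w − u, d⟫ ≥ (14/25) a`) has
`dist w v² ≤ R² − (28/25) a R + (51/50)² a²`. [folklore] -/
theorem ffrG_step {Y : Set (EuclideanSpace ℝ (Fin 3))} {a : ℝ}
    (spread : ∀ u ∈ Y, ∀ d : EuclideanSpace ℝ (Fin 3), ‖d‖ = 1 →
      ∃ w ∈ Y, w ≠ u ∧ dist u w ≤ a * (1 + 1 / 50) ∧ 14 / 25 * a ≤ inner ℝ (w - u) d)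
    {u v : EuclideanSpace ℝ (Fin 3)} (hu : u ∈ Y) (huv : u ≠ v) :
    ∃ w ∈ Y, dist u w ≤ a * (1 + 1 / 50) ∧
      dist w v ^ 2 ≤ dist u v ^ 2 - 28 / 25 * a * dist u v + (51 / 50) ^ 2 * a ^ 2 := by
  have hR : 0 < dist u v := dist_pos.2 huv
  set d : EuclideanSpace ℝ (Fin 3) := (dist u v)⁻¹ • (v - u) with hd
  have hd1 : ‖d‖ = 1 := by
    rw [hd, norm_smul, norm_inv, Real.norm_of_nonneg dist_nonneg, ← dist_eq_norm, dist_comm v u,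
      inv_mul_cancel₀ hR.ne']
  obtain ⟨w, hwY, -, hduw, hinner⟩ := spread u hu d hd1
  refine ⟨w, hwY, hduw, ?_⟩
  have e1 : dist w v ^ 2 = dist u v ^ 2 - 2 * ⟪v - u, w - u⟫ + dist u w ^ 2 := by
    have h1 : dist w v = ‖(v - u) - (w - u)‖ := by
      rw [dist_comm, dist_eq_norm]
      congr 1
      abel
    have h2 : dist u v = ‖v - u‖ := by rw [dist_comm, dist_eq_norm]
    have h3 : dist u w = ‖w - u‖ := by rw [dist_comm, dist_eq_norm]
    rw [h1, h2, h3, norm_sub_sq_real]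
  have e2 : dist u v * ⟪w - u, d⟫ = ⟪v - u, w - u⟫ := by
    rw [hd, real_inner_smul_right, ← mul_assoc, mul_inv_cancel₀ hR.ne', one_mul, real_inner_comm]
  have hb := pow_le_pow_left₀ dist_nonneg hduw 2
  have hi := mul_le_mul_of_nonneg_left hinner hR.le
  rw [e1, ← e2]
  nlinarith

/-- **Endgame, two bonds.**  If `dist u v ² ≤ (4521/2500) a² = 1.8084 a²` then `u` and `v` are joined
by a bond path of length `≤ 2`: either `dist u v < 1.26 a` already, or one greedy step lands at
squared distance `≤ 1.8084 a² − 1.12 · 1.26 a² + 1.0404 a² = 1.4376 a² < (1.26 a)²`. [folklore] -/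
theorem ffrG_two {Y : Set (EuclideanSpace ℝ (Fin 3))} {a : ℝ} (ha : 0 < a)
    (hwin : ∀ y ∈ Y, ∀ w ∈ Y, w ≠ y → a * (1 - 1 / 50) ≤ dist y w ∧
      (dist y w ≤ a * (1 + 1 / 50) ∨ a * (63 / 50) ≤ dist y w))
    (spread : ∀ u ∈ Y, ∀ d : EuclideanSpace ℝ (Fin 3), ‖d‖ = 1 →
      ∃ w ∈ Y, w ≠ u ∧ dist u w ≤ a * (1 + 1 / 50) ∧ 14 / 25 * a ≤ inner ℝ (w - u) d)
    {u v : EuclideanSpace ℝ (Fin 3)} (hu : u ∈ Y) (hv : v ∈ Y)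
    (hR : dist u v ^ 2 ≤ 4521 / 2500 * a ^ 2) :
    ∃ (n : ℕ) (g : ℕ → EuclideanSpace ℝ (Fin 3)), g 0 = u ∧ g n = v ∧ (∀ k, g k ∈ Y) ∧
      (∀ k, k < n → dist (g k) (g (k + 1)) ≤ a * (1 + 1 / 50)) ∧ n ≤ 2 := by
  by_cases hlt : dist u v < a * (63 / 50)
  · obtain ⟨n, g, hg0, hgn, hgY, hgd, hn⟩ := ffrG_close hwin hu hv hlt
    exact ⟨n, g, hg0, hgn, hgY, hgd, by omega⟩
  · push Not at hlt
    have huv : u ≠ v := by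
      intro h
      rw [h, dist_self] at hlt
      nlinarith
    obtain ⟨w, hwY, hduw, hwv⟩ := ffrG_step spread hu huv
    have hlt' : dist w v < a * (63 / 50) := by
      refine lt_of_pow_lt_pow_left₀ 2 (by positivity) ?_
      nlinarith [mul_le_mul_of_nonneg_left hlt ha.le]
    obtain ⟨n, g, hg0, hgn, hgY, hgd, hn⟩ := ffrG_close hwin hwY hv hlt'
    obtain ⟨g', hg'0, hg'n, hg'Y, hg'd⟩ :=
      ffrG_prepend hu (g := g) (by rw [hg0]; exact hduw) hgn hgY hgd
    exact ⟨n + 1, g', hg'0, hg'n, hg'Y, hg'd, by omega⟩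

/-- **Iteration.**  By induction on `m`: sites at distance `< m · a/4` are joined by a bond path of
length `≤ 4 · dist/a + 3` (below `(8/5) a`: at most three bonds by the endgame; above: one greedy
step gains `≥ a/4`). [folklore] -/
theorem ffrG_iter {Y : Set (EuclideanSpace ℝ (Fin 3))} {a : ℝ} (ha : 0 < a)
    (hwin : ∀ y ∈ Y, ∀ w ∈ Y, w ≠ y → a * (1 - 1 / 50) ≤ dist y w ∧
      (dist y w ≤ a * (1 + 1 / 50) ∨ a * (63 / 50) ≤ dist y w))
    (spread : ∀ u ∈ Y, ∀ d : EuclideanSpace ℝ (Fin 3), ‖d‖ = 1 →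
      ∃ w ∈ Y, w ≠ u ∧ dist u w ≤ a * (1 + 1 / 50) ∧ 14 / 25 * a ≤ inner ℝ (w - u) d) (m : ℕ) :
    ∀ u ∈ Y, ∀ v ∈ Y, dist u v < m * (a / 4) →
      ∃ (n : ℕ) (g : ℕ → EuclideanSpace ℝ (Fin 3)), g 0 = u ∧ g n = v ∧ (∀ k, g k ∈ Y) ∧
        (∀ k, k < n → dist (g k) (g (k + 1)) ≤ a * (1 + 1 / 50)) ∧ (n : ℝ) ≤ 4 * dist u v / a + 3 := by
  induction m with
  | zero =>
    intro u _ v _ h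
    simp only [Nat.cast_zero, zero_mul] at h
    exact absurd h (not_lt.2 dist_nonneg)
  | succ m ih =>
    intro u hu v hv hlt
    have hnn : 0 ≤ 4 * dist u v / a := by positivity
    by_cases hR : dist u v < a * (8 / 5)
    · -- endgame: at most three bonds
      by_cases h1 : dist u v < a * (63 / 50)
      · obtain ⟨n, g, hg0, hgn, hgY, hgd, hn⟩ := ffrG_close hwin hu hv h1
        refine ⟨n, g, hg0, hgn, hgY, hgd, ?_⟩
        have : (n : ℝ) ≤ 1 := by exact_mod_cast hn
        linarith
      · push Not at h1
        have huv : u ≠ v := by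
          intro h
          rw [h, dist_self] at h1
          nlinarith
        obtain ⟨w, hwY, hduw, hwv⟩ := ffrG_step spread hu huv
        have hR2 : dist w v ^ 2 ≤ 4521 / 2500 * a ^ 2 := by
          nlinarith [mul_nonneg (sub_nonneg.2 hR.le) (by positivity : (0 : ℝ) ≤ dist u v + 12 / 25 * a)]
        obtain ⟨n, g, hg0, hgn, hgY, hgd, hn⟩ := ffrG_two ha hwin spread hwY hv hR2
        obtain ⟨g', hg'0, hg'n, hg'Y, hg'd⟩ :=
          ffrG_prepend hu (g := g) (by rw [hg0]; exact hduw) hgn hgY hgd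
        refine ⟨n + 1, g', hg'0, hg'n, hg'Y, hg'd, ?_⟩
        have : ((n + 1 : ℕ) : ℝ) ≤ 3 := by exact_mod_cast (by omega : n + 1 ≤ 3)
        linarith
    · -- one greedy step gains `≥ a/4`
      push Not at hR
      have huv : u ≠ v := by
        intro h
        rw [h, dist_self] at hR
        nlinarith
      obtain ⟨w, hwY, hduw, hwv⟩ := ffrG_step spread hu huv
      have hle : dist w v ≤ dist u v - a / 4 := by
        refine le_of_pow_le_pow_left₀ two_ne_zero (by linarith) ?_
        nlinarith [mul_le_mul_of_nonneg_left hR ha.le]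
      have hlt' : dist w v < m * (a / 4) := by
        push_cast at hlt
        linarith
      obtain ⟨n, g, hg0, hgn, hgY, hgd, hn⟩ := ih w hwY v hv hlt'
      obtain ⟨g', hg'0, hg'n, hg'Y, hg'd⟩ :=
        ffrG_prepend hu (g := g) (by rw [hg0]; exact hduw) hgn hgY hgd
      refine ⟨n + 1, g', hg'0, hg'n, hg'Y, hg'd, ?_⟩
      have hdiv : 4 * dist w v / a ≤ 4 * dist u v / a - 1 := by
        rw [div_le_iff₀ ha, sub_mul, div_mul_cancel₀ _ ha.ne']
        linarith
      push_cast
      linarith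

/-- **Stub G (GREEDY ROUTING).** In an all-gapped-twelve torn-free configuration with link
types, any two sites `u, v` are joined by a bond path in `Y` of length `≤ 4 · dist u v / a + 3`:
directional spread `(14/25) a` of the bond partners (`stub_ffrSpread`: `0` is interior to the radial
hull, every direction lies in the cone of a fan triangle, fan triangles have two bond sides and a far
side that is a bond or a quad diagonal `≤ 1.604 a`), then greedy steps gaining `≥ a/4` above `(8/5) a`
and an endgame of at most three bonds below, the gap `(1.02 a, 1.26 a)` turning the last short
distance into a bond. [folklore] -/
theorem stub_ffrGreedy :
    ∀ (Y : Set (EuclideanSpace ℝ (Fin 3))) (a : ℝ), 0 < a →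
      (∀ y ∈ Y, ({w ∈ Y | w ≠ y ∧ dist y w ≤ a * (1 + 1 / 50)}.ncard = 12 ∧
        ∀ w ∈ Y, w ≠ y → a * (1 - 1 / 50) ≤ dist y w ∧
          (dist y w ≤ a * (1 + 1 / 50) ∨ a * (63 / 50) ≤ dist y w))) →
      (∀ y ∈ Y, ∀ v ∈ Y, v ≠ y → dist y v ≤ a * (1 + 1 / 50) →
        4 ≤ {w ∈ Y | w ≠ y ∧ w ≠ v ∧ dist y w ≤ a * (1 + 1 / 50) ∧ dist v w ≤ a * (1 + 1 / 50)}.ncard) →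
      (∀ y ∈ Y, ∃ e : Fin 12 → EuclideanSpace ℝ (Fin 3), Function.Injective e ∧
        Set.range e = {w ∈ Y | w ≠ y ∧ dist y w ≤ a * (1 + 1 / 50)} ∧
        ((∀ i j : Fin 12, i < j → (dist (e i) (e j) ≤ a * (1 + 1 / 50) ↔
            (i.val, j.val) ∈ ([(0, 4), (0, 5), (0, 8), (0, 9), (1, 4), (1, 5), (1, 10), (1, 11), (2, 6), (2, 7),
                (2, 8), (2, 9), (3, 6), (3, 7), (3, 10), (3, 11), (4, 8), (4, 10), (5, 9), (5, 11),
                (6, 8), (6, 10), (7, 9), (7, 11)] : List (ℕ × ℕ)))) ∨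
          (∀ i j : Fin 12, i < j → (dist (e i) (e j) ≤ a * (1 + 1 / 50) ↔
            (i.val, j.val) ∈ ([(0, 2), (0, 5), (0, 7), (0, 10), (1, 3), (1, 4), (1, 8), (1, 11), (2, 4), (2, 6),
                (2, 9), (3, 5), (3, 8), (3, 11), (4, 6), (4, 9), (5, 7), (5, 10), (6, 7), (6, 8),
                (7, 8), (9, 10), (9, 11), (10, 11)] : List (ℕ × ℕ)))) ∨
          (∀ i j : Fin 12, i < j → (dist (e i) (e j) ≤ a * (1 + 1 / 50) ↔
            (i.val, j.val) ∈ ([(0, 1), (0, 2), (0, 3), (0, 4), (0, 5), (1, 2), (1, 5), (1, 6), (2, 3), (2, 7), (3, 4),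
                (3, 8), (4, 5), (4, 9), (5, 10), (6, 7), (6, 10), (6, 11), (7, 8), (7, 11), (8, 9),
                (8, 11), (9, 10), (9, 11), (10, 11)] : List (ℕ × ℕ)))))) →
      (∀ u ∈ Y, ∀ v ∈ Y, ∃ (n : ℕ) (g : ℕ → EuclideanSpace ℝ (Fin 3)), g 0 = u ∧ g n = v ∧ (∀ k, g k ∈ Y) ∧
        (∀ k, k < n → dist (g k) (g (k + 1)) ≤ a * (1 + 1 / 50)) ∧ (n : ℝ) ≤ 4 * dist u v / a + 3) := by
  intro Y a ha hgap _ hL u hu v hv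
  have hwin := fun y hy w hw hne => (hgap y hy).2 w hw hne
  have spread := stub_ffrSpread Y a ha hgap hL
  obtain ⟨m, hm⟩ := exists_nat_gt (4 * dist u v / a)
  refine ffrG_iter ha hwin spread m u hu v hv ?_
  rw [div_lt_iff₀ ha] at hm
  linarith

end Summit.AtomisticToContinuum.Crystallization.Theorems

end
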